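import Summits.Ventures.Crystal3D.Theorems.StickyWulffConstantNoReconstructionGainNoK1122
import HarnessLib

/-!
# Three mutually touching balls have at most two common neighbours (criminal anatomy brick, line `replication-exactness`)

HONEST FRAMING. Part of the venture `Summits/Ventures/Crystal3D` (cell `crystal3d-full`), helper `--supports` the
crux `NoReconstructionGain` (stmt-Ventures-19144, route `route-Ventures-StickyWulffConstant`), lead wulff-p1 g19.  The
third forbidden contact pattern after `K₅` (`no_five_pairwise_dist_two`) and `K_{1,1,2,2}` (`no_K1122_contacts`): the
complete graph `K₆` minus a triangle — in fact any three DISTINCT points each touching all three balls of a unit triangle.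

* `no_three_common_of_unit_triangle` — if `s₁, s₂, s₃` are pairwise at distance `1`, there are no three pairwise distinct
  points `t₁, t₂, t₃` each at distance `1` from `s₁`, `s₂` and `s₃` (the two apices of the regular tetrahedra on the
  triangle are the only candidates).  Proof: with `u = s₁`, the unit vectors `e₁ = s₂ − u`, `e₂ = s₃ − u`, `xᵢ = tᵢ − u`
  satisfy the hypotheses of `inner_eq_one_or_eq_neg_third`, so `⟪xᵢ, xⱼ⟫ = −1/3` for `i ≠ j`, and then
  `‖x₁ + x₂ + x₃ − e₁ − e₂‖² = −2`.

WHAT THIS IS NOT: nothing about films by itself; rung F-C1 not moved.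
-/

noncomputable section

namespace Summit.Ventures.Crystal3D.Theorems

open scoped InnerProductSpace

/-- **A unit triangle has at most two common neighbours**: no three pairwise distinct points are each at distance
`1` from all three vertices of a triangle with unit sides. -/
theorem no_three_common_of_unit_triangle (s₁ s₂ s₃ t₁ t₂ t₃ : EuclideanSpace ℝ (Fin 3))
    (h12 : dist s₁ s₂ = 1) (h13 : dist s₁ s₃ = 1) (h23 : dist s₂ s₃ = 1)
    (ht12 : t₁ ≠ t₂) (ht13 : t₁ ≠ t₃) (ht23 : t₂ ≠ t₃)
    (g11 : dist s₁ t₁ = 1) (g21 : dist s₂ t₁ = 1) (g31 : dist s₃ t₁ = 1)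
    (g12 : dist s₁ t₂ = 1) (g22 : dist s₂ t₂ = 1) (g32 : dist s₃ t₂ = 1)
    (g13 : dist s₁ t₃ = 1) (g23 : dist s₂ t₃ = 1) (g33 : dist s₃ t₃ = 1) : False := by
  set E₁ := s₂ - s₁ with hE₁
  set E₂ := s₃ - s₁ with hE₂
  set X₁ := t₁ - s₁ with hX₁
  set X₂ := t₂ - s₁ with hX₂
  set X₃ := t₃ - s₁ with hX₃
  have nrm : ∀ {p : EuclideanSpace ℝ (Fin 3)}, dist s₁ p = 1 → ‖p - s₁‖ = 1 := by
    intro p h; rwa [← dist_eq_norm, dist_comm]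
  have nE₁ : ‖E₁‖ = 1 := nrm h12
  have nE₂ : ‖E₂‖ = 1 := nrm h13
  have nX₁ : ‖X₁‖ = 1 := nrm g11
  have nX₂ : ‖X₂‖ = 1 := nrm g12
  have nX₃ : ‖X₃‖ = 1 := nrm g13
  have sub : ∀ p q : EuclideanSpace ℝ (Fin 3), (q - s₁) - (p - s₁) = q - p := fun p q => by abel
  have tri : ∀ {p q : EuclideanSpace ℝ (Fin 3)}, dist p q = 1 → ‖p - s₁‖ = 1 → ‖q - s₁‖ = 1 →
      ⟪p - s₁, q - s₁⟫_ℝ = 1 / 2 := by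
    intro p q h hp hq
    refine inner_eq_half_of_unit_triangle hp hq ?_
    rw [sub, ← dist_eq_norm, dist_comm, h]
  have iE₁E₂ : ⟪E₁, E₂⟫_ℝ = 1 / 2 := tri h23 nE₁ nE₂
  have iE₁X₁ : ⟪E₁, X₁⟫_ℝ = 1 / 2 := tri g21 nE₁ nX₁
  have iE₁X₂ : ⟪E₁, X₂⟫_ℝ = 1 / 2 := tri g22 nE₁ nX₂
  have iE₁X₃ : ⟪E₁, X₃⟫_ℝ = 1 / 2 := tri g23 nE₁ nX₃
  have iX₁E₂ : ⟪X₁, E₂⟫_ℝ = 1 / 2 := by rw [real_inner_comm]; exact tri g31 nE₂ nX₁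
  have iX₂E₂ : ⟪X₂, E₂⟫_ℝ = 1 / 2 := by rw [real_inner_comm]; exact tri g32 nE₂ nX₂
  have iX₃E₂ : ⟪X₃, E₂⟫_ℝ = 1 / 2 := by rw [real_inner_comm]; exact tri g33 nE₂ nX₃
  -- pairwise inner products of the `Xᵢ` are `−1/3`
  have key : ∀ {X X' : EuclideanSpace ℝ (Fin 3)} {t t' : EuclideanSpace ℝ (Fin 3)}, X = t - s₁ → X' = t' - s₁ →
      t ≠ t' → ‖X‖ = 1 → ‖X'‖ = 1 → ⟪E₁, X⟫_ℝ = 1 / 2 → ⟪E₁, X'⟫_ℝ = 1 / 2 → ⟪X, E₂⟫_ℝ = 1 / 2 →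
      ⟪X', E₂⟫_ℝ = 1 / 2 → ⟪X, X'⟫_ℝ = -1 / 3 := by
    intro X X' t t' hX hX' hne nX nX' h1 h2 h3 h4
    rcases inner_eq_one_or_eq_neg_third nE₁ nX nE₂ nX' h1 iE₁E₂ h2 h3 h4 with h | h
    · exfalso; apply hne
      have e := norm_sub_sq_real X X'
      rw [nX, nX', h] at e
      have h0 : ‖X - X'‖ = 0 := by nlinarith [norm_nonneg (X - X')]
      rw [norm_eq_zero, sub_eq_zero, hX, hX'] at h0
      simpa using congrArg (· + s₁) h0
    · exact h
  have i12 : ⟪X₁, X₂⟫_ℝ = -1 / 3 := key hX₁ hX₂ ht12 nX₁ nX₂ iE₁X₁ iE₁X₂ iX₁E₂ iX₂E₂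
  have i13 : ⟪X₁, X₃⟫_ℝ = -1 / 3 := key hX₁ hX₃ ht13 nX₁ nX₃ iE₁X₁ iE₁X₃ iX₁E₂ iX₃E₂
  have i23 : ⟪X₂, X₃⟫_ℝ = -1 / 3 := key hX₂ hX₃ ht23 nX₂ nX₃ iE₁X₂ iE₁X₃ iX₂E₂ iX₃E₂
  have sE₁ : ⟪E₁, E₁⟫_ℝ = 1 := by rw [real_inner_self_eq_norm_sq, nE₁]; norm_num
  have sE₂ : ⟪E₂, E₂⟫_ℝ = 1 := by rw [real_inner_self_eq_norm_sq, nE₂]; norm_num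
  have sX₁ : ⟪X₁, X₁⟫_ℝ = 1 := by rw [real_inner_self_eq_norm_sq, nX₁]; norm_num
  have sX₂ : ⟪X₂, X₂⟫_ℝ = 1 := by rw [real_inner_self_eq_norm_sq, nX₂]; norm_num
  have sX₃ : ⟪X₃, X₃⟫_ℝ = 1 := by rw [real_inner_self_eq_norm_sq, nX₃]; norm_num
  have hnn : 0 ≤ ⟪X₁ + X₂ + X₃ - E₁ - E₂, X₁ + X₂ + X₃ - E₁ - E₂⟫_ℝ := real_inner_self_nonneg
  simp only [inner_add_left, inner_add_right, inner_sub_left, inner_sub_right] at hnn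
  have c1 : ⟪X₁, E₁⟫_ℝ = 1 / 2 := by rw [real_inner_comm]; exact iE₁X₁
  have c2 : ⟪X₂, E₁⟫_ℝ = 1 / 2 := by rw [real_inner_comm]; exact iE₁X₂
  have c3 : ⟪X₃, E₁⟫_ℝ = 1 / 2 := by rw [real_inner_comm]; exact iE₁X₃
  have c4 : ⟪E₂, X₁⟫_ℝ = 1 / 2 := by rw [real_inner_comm]; exact iX₁E₂
  have c5 : ⟪E₂, X₂⟫_ℝ = 1 / 2 := by rw [real_inner_comm]; exact iX₂E₂
  have c6 : ⟪E₂, X₃⟫_ℝ = 1 / 2 := by rw [real_inner_comm]; exact iX₃E₂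
  have c7 : ⟪E₂, E₁⟫_ℝ = 1 / 2 := by rw [real_inner_comm]; exact iE₁E₂
  have c8 : ⟪X₂, X₁⟫_ℝ = -1 / 3 := by rw [real_inner_comm]; exact i12
  have c9 : ⟪X₃, X₁⟫_ℝ = -1 / 3 := by rw [real_inner_comm]; exact i13
  have c10 : ⟪X₃, X₂⟫_ℝ = -1 / 3 := by rw [real_inner_comm]; exact i23
  linarith

end Summit.Ventures.Crystal3D.Theorems

end
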